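import Summits.AtomisticToContinuum.BoseEinsteinCondensation.Theorems.BECThomsonPrincipleGDTransferSeededWitnessDefs
import Summits.AtomisticToContinuum.BoseEinsteinCondensation.Theorems.BECThomsonPrincipleGDTransferSeededProjectedDichotomySector
import Summits.AtomisticToContinuum.BoseEinsteinCondensation.Theorems.BECThomsonPrincipleGDTransferSeededCountLaw

/-!
# Route `BECThomsonPrinciple`, crux `GDTransfer` (stmt-AtomisticToContinuum-9482), line `seeded-continuity`:
# stub `stub_bandFromWindow`, part 1 — the SECOND-MOMENT COUNT IDENTITY of the weighted occupations

Support file of the registered stub `stub_bandFromWindow : Sig.stub_bandFromWindow`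
(`Theorems/BECThomsonPrincipleGDTransferSeededWitnessDefs.lean`).  For a periodic trial state `Ψ` of `N = m + 1`
bosons, with `w_S = compMass m L S Ψ.ψ = ∫|Q_S Ψ|²` the `n̂₀`-law through the crux's mode projections and
`weightedOcc m L p Ψ.ψ = N⁻¹ ∫|Σ_i P_i^{(p)}Ψ|²` (`= N⁻¹‖a₀†a_pΨ‖²`) the weighted occupation of the mode `p`:

  `N · Σ_{p ≠ 0} weightedOcc p = Σ_T (|T| + 1)(N − |T|) w_T`   (`= ⟨Ψ, (n̂₀ + 1)(N − n̂₀)Ψ⟩`),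

`natCast_mul_tsum_weightedOcc`.  Mechanism (first quantisation, no polarisation needed):
* Pythagoras over the orthogonal `Q_S` and Bose symmetry inside `S` (landed `Lnss.inv_card_mul_integral_norm_sq_modeProj`):
  `∫|Σ_i P_i^{(p)}Ψ|² = Σ_S |S| Σ_{i∈S} ∫|Q_S P_i^{(p)}Ψ|²` (`lintegral_sum_fourierAvg`);
* the creator slot operator RAISES the sector (landed `Sector.modeProj_fourierAvg_of_mem`): for `p ≠ 0`, `i ∈ S`,
  `Q_S P_i^{(p)}Ψ = P_i^{(p)} Q_{S∖{i}}Ψ`;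
* the UNARY ONE-SLOT PARSEVAL `Σ_p ∫|P_i^{(p)} g|² = ∫|g|²` for continuous `g` (`tsum_lintegral_fourierAvg`: the slice
  formula `N∫|P_0^{(p)}g|² = n_p(g)` as in `Lnss.mass_lnssLower`, Parseval in the traced variable
  `tsum_cellOccupation_planeWaveMode_eq`, and a relabelling for the other slots), whose `p = 0` term
  `∫|P_i Q_T g|²` vanishes for `i ∉ T`, so `Σ_{p≠0} ∫|P_i^{(p)}Q_T Ψ|² = w_T`;
* the reindexing `(S, i ∈ S) ↔ (T, i ∉ T)`, `T = S ∖ {i}`, `|S| = |T| + 1`, `#{i ∉ T} = N − |T|` (`sum_sum_erase`).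
All [folklore] (LSSY2005 App. A; arXiv:1211.2778 §2).
-/

noncomputable section

open MeasureTheory Filter
open scoped ENNReal NNReal ComplexConjugate

namespace Summit.AtomisticToContinuum.BoseEinsteinCondensation.Cruxes.GDTransfer.Seeded

namespace SecondMoment

open Literature.MathematicalPhysics.QuantumManyBody.BoseGas
open Summit.AtomisticToContinuum.BoseEinsteinCondensation.Theorems.GaussianDominationCan.Negative
open Summit.AtomisticToContinuum.BoseEinsteinCondensation.Cruxes.GDTransfer.DysonDressedWitness
open ChordVariation (continuous_modeProj mass_smul)
open Lnss

variable {m : ℕ} {L : ℝ}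

/-! ## The unary one-slot Parseval identity -/

/-- **Slice formula**: `N · ∫_{cell^N}|P_0^{(p)} g|² = n_p(g)` for continuous `g` (the slice of `P_0^{(p)}g` is the
cell Fourier coefficient of the slice of `g`). [folklore] -/
theorem natCast_mul_lintegral_fourierAvg_zero (hL : 0 < L) (p : Fin 3 → ℤ) {g : Config (m + 1) → ℂ}
    (hg : Continuous g) :
    ((m + 1 : ℕ) : ℝ≥0∞) * ∫⁻ X in cellN (m + 1) L, (‖fourierAvg m L p 0 g X‖₊ : ℝ≥0∞) ^ 2 =
      cellOccupation (m + 1) L (planeWaveMode L p) g := by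
  -- adapted from the tail of `Lnss.mass_lnssLower`
  have h0 : Continuous (fourierAvg m L p 0 g) := continuous_fourierAvg p 0 hg
  have hmeas : Measurable fun X : Config (m + 1) => ((‖fourierAvg m L p 0 g X‖₊ : ℝ≥0∞)) ^ 2 :=
    (h0.measurable.nnnorm.coe_nnreal_ennreal).pow_const _
  rw [cellOccupation_succ, lintegral_cellN_succ L hmeas]
  push_cast
  congr 1
  refine lintegral_congr fun Y => ?_
  rw [nnnorm_sq_integral_conj_planeWaveMode_mul hL p (fun x => g (Matrix.vecCons x Y))]
  simp only [fourierAvg_zero_vecCons hL]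
  rw [lintegral_cell_const, mul_comm]

/-- **Unary one-slot Parseval in slot `0`**: `Σ_p ∫_{cell^N}|P_0^{(p)} g|² = ∫_{cell^N}|g|²` for continuous `g`.
[folklore] -/
theorem tsum_lintegral_fourierAvg_zero (hL : 0 < L) {g : Config (m + 1) → ℂ} (hg : Continuous g) :
    ∑' p : Fin 3 → ℤ, ∫⁻ X in cellN (m + 1) L, (‖fourierAvg m L p 0 g X‖₊ : ℝ≥0∞) ^ 2 =
      ∫⁻ X in cellN (m + 1) L, (‖g X‖₊ : ℝ≥0∞) ^ 2 := by
  have hN0 : ((m + 1 : ℕ) : ℝ≥0∞) ≠ 0 := Nat.cast_ne_zero.2 (Nat.succ_ne_zero m)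
  have hNtop : ((m + 1 : ℕ) : ℝ≥0∞) ≠ ⊤ := ENNReal.natCast_ne_top _
  have h : ((m + 1 : ℕ) : ℝ≥0∞) *
      ∑' p : Fin 3 → ℤ, ∫⁻ X in cellN (m + 1) L, (‖fourierAvg m L p 0 g X‖₊ : ℝ≥0∞) ^ 2 =
        ((m + 1 : ℕ) : ℝ≥0∞) * ∫⁻ X in cellN (m + 1) L, (‖g X‖₊ : ℝ≥0∞) ^ 2 := by
    rw [← ENNReal.tsum_mul_left]
    simp only [natCast_mul_lintegral_fourierAvg_zero hL _ hg]
    exact tsum_cellOccupation_planeWaveMode_eq hL hg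
  exact (ENNReal.mul_right_inj hN0 hNtop).1 h

/-- **Unary one-slot Parseval in any slot**: `Σ_p ∫_{cell^N}|P_i^{(p)} g|² = ∫_{cell^N}|g|²` for continuous `g`
(relabelling `X ↦ X ∘ (0 i)`). [folklore] -/
theorem tsum_lintegral_fourierAvg (hL : 0 < L) (i : Fin (m + 1)) {g : Config (m + 1) → ℂ} (hg : Continuous g) :
    ∑' p : Fin 3 → ℤ, ∫⁻ X in cellN (m + 1) L, (‖fourierAvg m L p i g X‖₊ : ℝ≥0∞) ^ 2 =
      ∫⁻ X in cellN (m + 1) L, (‖g X‖₊ : ℝ≥0∞) ^ 2 := by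
  have hgτ : Continuous fun Y : Config (m + 1) => g (Y ∘ Equiv.swap 0 i) :=
    hg.comp (continuous_pi fun j => continuous_apply (Equiv.swap 0 i j))
  have h1 : ∀ p : Fin 3 → ℤ, ∫⁻ X in cellN (m + 1) L, (‖fourierAvg m L p i g X‖₊ : ℝ≥0∞) ^ 2 =
      ∫⁻ X in cellN (m + 1) L, (‖fourierAvg m L p 0 (fun Y => g (Y ∘ Equiv.swap 0 i)) X‖₊ : ℝ≥0∞) ^ 2 := by
    intro p
    rw [← lintegral_cellN_comp_perm (Equiv.swap 0 i) (fun X => (‖fourierAvg m L p i g X‖₊ : ℝ≥0∞) ^ 2)]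
    refine lintegral_congr fun X => ?_
    rw [fourierAvg_comp_perm p (Equiv.swap 0 i) i g X, Equiv.swap_apply_right]
  have h2 : ∫⁻ X in cellN (m + 1) L, (‖g X‖₊ : ℝ≥0∞) ^ 2 =
      ∫⁻ X in cellN (m + 1) L, (‖g (X ∘ Equiv.swap 0 i)‖₊ : ℝ≥0∞) ^ 2 :=
    (lintegral_cellN_comp_perm (Equiv.swap 0 i) (fun X => (‖g X‖₊ : ℝ≥0∞) ^ 2)).symm
  rw [tsum_congr h1, h2]
  exact tsum_lintegral_fourierAvg_zero hL hgτ

/-- `P_i^{(0)} = P_i`. [folklore] -/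
theorem fourierAvg_modeZero (i : Fin (m + 1)) (g : Config (m + 1) → ℂ) :
    fourierAvg m L 0 i g = cellAvg (m + 1) L i g := by
  rw [← cellAvg_conj_cellWave_mul 0 i g]
  simp only [cellWave_zero, map_one, one_mul]

/-- **Off the zero mode, in a slot outside `T`**: `Σ_{p≠0} ∫|P_i^{(p)} Q_T g|² = w_T(g)` for `i ∉ T` and continuous `g`
(the `p = 0` term is `∫|P_i Q_T g|² = 0`). [folklore] -/
theorem tsum_indicator_lintegral_fourierAvg_modeProj (hL : 0 < L) {T : Finset (Fin (m + 1))} {i : Fin (m + 1)}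
    (hi : i ∉ T) {g : Config (m + 1) → ℂ} (hg : Continuous g) :
    ∑' p : Fin 3 → ℤ, {p : Fin 3 → ℤ | p ≠ 0}.indicator
        (fun p => ∫⁻ X in cellN (m + 1) L,
          (‖fourierAvg m L p i (modeProj (m + 1) L T g) X‖₊ : ℝ≥0∞) ^ 2) p =
      compMass m L T g := by
  have hQ : Continuous (modeProj (m + 1) L T g) := continuous_modeProj T hg
  have hzero : fourierAvg m L 0 i (modeProj (m + 1) L T g) = 0 := by
    rw [fourierAvg_modeZero, cellAvg_modeProj hL T i hg, if_neg hi]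
  have hind : ∀ p : Fin 3 → ℤ, {p : Fin 3 → ℤ | p ≠ 0}.indicator
      (fun p => ∫⁻ X in cellN (m + 1) L,
        (‖fourierAvg m L p i (modeProj (m + 1) L T g) X‖₊ : ℝ≥0∞) ^ 2) p =
      ∫⁻ X in cellN (m + 1) L, (‖fourierAvg m L p i (modeProj (m + 1) L T g) X‖₊ : ℝ≥0∞) ^ 2 := by
    intro p
    by_cases hp : p = 0
    · rw [Set.indicator_of_notMem (fun h : p ≠ 0 => h hp), hp, hzero]
      simp
    · exact Set.indicator_of_mem hp _
  rw [tsum_congr hind, tsum_lintegral_fourierAvg hL i hQ]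
  rfl

/-! ## Pythagoras over the sectors for `a₀†a_p Ψ = Σ_i P_i^{(p)} Ψ` -/

/-- **`∫|Σ_i P_i^{(p)}ψ|² = Σ_S |S| Σ_{i∈S} ∫|Q_S P_i^{(p)}ψ|²`** for continuous Bose-symmetric `ψ` (Pythagoras over the
orthogonal `Q_S`, and `Q_S P_i^{(p)}ψ = Q_S P_j^{(p)}ψ` for `i, j ∈ S`, `= 0` for `i ∉ S`). [folklore] -/
theorem lintegral_sum_fourierAvg (hL : 0 < L) (p : Fin 3 → ℤ) {ψ : Config (m + 1) → ℂ} (hψ : Continuous ψ)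
    (hψs : ∀ (σ : Equiv.Perm (Fin (m + 1))) (X : Config (m + 1)), ψ (X ∘ σ) = ψ X) :
    ∫⁻ X in cellN (m + 1) L, (‖∑ i, fourierAvg m L p i ψ X‖₊ : ℝ≥0∞) ^ 2 =
      ∑ S : Finset (Fin (m + 1)), (S.card : ℝ≥0∞) *
        ∑ i ∈ S, ∫⁻ X in cellN (m + 1) L, (‖modeProj (m + 1) L S (fourierAvg m L p i ψ) X‖₊ : ℝ≥0∞) ^ 2 := by
  have hh : Continuous fun X => ∑ i, fourierAvg m L p i ψ X := continuous_sum_fourierAvg p hψ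
  have hFi : ∀ i, Continuous (fourierAvg m L p i ψ) := fun i => continuous_fourierAvg p i hψ
  rw [← sum_compMass_eq_lintegral hL hh]
  refine Finset.sum_congr rfl fun S _ => ?_
  unfold compMass
  rw [lintegral_nnnorm_sq_eq _ (continuous_modeProj S hh)]
  rcases S.eq_empty_or_nonempty with rfl | hS
  · have hQ0 : modeProj (m + 1) L ∅ (fun X => ∑ i, fourierAvg m L p i ψ X) = 0 := by
      rw [modeProj_finset_sum _ (fun i _ => hFi i)]
      funext X
      simp only [modeProj_fourierAvg_eq_zero hL p (Finset.notMem_empty _) hψ, Pi.zero_apply,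
        Finset.sum_const_zero]
    simp [hQ0]
  · have key := inv_card_mul_integral_norm_sq_modeProj hL p hS hψ hψs
    rw [norm_sq_coef] at key
    have hcard : (S.card : ℝ) ≠ 0 := Nat.cast_ne_zero.2 (Finset.card_pos.2 hS).ne'
    have e : ∫ X in cellN (m + 1) L, ‖modeProj (m + 1) L S (fun X => ∑ i, fourierAvg m L p i ψ X) X‖ ^ 2 =
        (S.card : ℝ) * ∑ i ∈ S, ∫ X in cellN (m + 1) L, ‖modeProj (m + 1) L S (fourierAvg m L p i ψ) X‖ ^ 2 := by
      rw [← key, ← mul_assoc, mul_inv_cancel₀ hcard, one_mul]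
    rw [e, ENNReal.ofReal_mul (Nat.cast_nonneg _), ENNReal.ofReal_natCast,
      ENNReal.ofReal_sum_of_nonneg (fun i _ => integral_nonneg fun X => sq_nonneg _)]
    congr 1
    refine Finset.sum_congr rfl fun i _ => ?_
    rw [lintegral_nnnorm_sq_eq _ (continuous_modeProj S (hFi i))]

/-- The weighted occupation through `a₀†a_p`: `weightedOcc p ψ = N⁻¹ ∫|Σ_i P_i^{(p)}ψ|²`. [folklore] -/
theorem weightedOcc_eq (p : Fin 3 → ℤ) (ψ : Config (m + 1) → ℂ) :
    weightedOcc m L p ψ =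
      ((m + 1 : ℕ) : ℝ≥0∞)⁻¹ * ∫⁻ X in cellN (m + 1) L, (‖∑ i, fourierAvg m L p i ψ X‖₊ : ℝ≥0∞) ^ 2 := by
  have hN : (0 : ℝ) < ((m + 1 : ℕ) : ℝ) := Nat.cast_pos.2 (Nat.succ_pos m)
  have hcoef : ((‖((Real.sqrt ((m + 1 : ℕ) : ℝ))⁻¹ : ℂ)‖₊ : ℝ≥0∞)) ^ 2 = ((m + 1 : ℕ) : ℝ≥0∞)⁻¹ := by
    rw [← ENNReal.coe_pow, ← ENNReal.ofReal_coe_nnreal, NNReal.coe_pow, coe_nnnorm, norm_inv, Complex.norm_real,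
      Real.norm_of_nonneg (Real.sqrt_nonneg _), inv_pow, Real.sq_sqrt hN.le, ENNReal.ofReal_inv_of_pos hN,
      ENNReal.ofReal_natCast]
  unfold weightedOcc plainDown
  rw [mass_smul, hcoef]
  rfl

/-! ## The reindexing `(S, i ∈ S) ↔ (T, i ∉ T)` -/

/-- **Reindexing**: `Σ_S Σ_{i∈S} f(S ∖ {i}, i) = Σ_T Σ_{i∉T} f(T, i)` (the bijection `T = S ∖ {i}`, `S = T ∪ {i}`).
[folklore] -/
theorem sum_sum_erase {α : Type*} [AddCommMonoid α] {n : ℕ} (f : Finset (Fin n) → Fin n → α) :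
    ∑ S : Finset (Fin n), ∑ i ∈ S, f (S.erase i) i = ∑ T : Finset (Fin n), ∑ i ∈ Tᶜ, f T i := by
  calc ∑ S : Finset (Fin n), ∑ i ∈ S, f (S.erase i) i
      = ∑ i : Fin n, ∑ S ∈ (Finset.univ : Finset (Finset (Fin n))).filter (fun S => i ∈ S), f (S.erase i) i :=
        Finset.sum_comm' fun S i => by simp
    _ = ∑ i : Fin n, ∑ T ∈ (Finset.univ : Finset (Finset (Fin n))).filter (fun T => i ∉ T), f T i := by
        refine Finset.sum_congr rfl fun i _ => ?_
        refine Finset.sum_nbij' (fun S => S.erase i) (fun T => insert i T) ?_ ?_ ?_ ?_ ?_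
        · intro S _
          simp
        · intro T _
          simp
        · intro S hS
          exact Finset.insert_erase (by simpa using hS)
        · intro T hT
          exact Finset.erase_insert (by simpa using hT)
        · intro S _
          rfl
    _ = ∑ T : Finset (Fin n), ∑ i ∈ Tᶜ, f T i :=
        Finset.sum_comm' fun i T => by simp [Finset.mem_compl]

/-- **The second-moment weights**: `Σ_S |S| Σ_{i∈S} w(S ∖ {i}) = Σ_T (|T|+1)(N − |T|) w(T)`. [folklore] -/
theorem sum_card_mul_sum_erase (w : Finset (Fin (m + 1)) → ℝ≥0∞) :
    ∑ S : Finset (Fin (m + 1)), (S.card : ℝ≥0∞) * ∑ i ∈ S, w (S.erase i) =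
      ∑ T : Finset (Fin (m + 1)), (((T.card + 1) * (m + 1 - T.card) : ℕ) : ℝ≥0∞) * w T := by
  calc ∑ S : Finset (Fin (m + 1)), (S.card : ℝ≥0∞) * ∑ i ∈ S, w (S.erase i)
      = ∑ S : Finset (Fin (m + 1)), ∑ i ∈ S, (((S.erase i).card + 1 : ℕ) : ℝ≥0∞) * w (S.erase i) := by
        refine Finset.sum_congr rfl fun S _ => ?_
        rw [Finset.mul_sum]
        refine Finset.sum_congr rfl fun i hi => ?_
        rw [Finset.card_erase_add_one hi]
    _ = ∑ T : Finset (Fin (m + 1)), ∑ i ∈ Tᶜ, ((T.card + 1 : ℕ) : ℝ≥0∞) * w T :=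
        sum_sum_erase (fun T _ => ((T.card + 1 : ℕ) : ℝ≥0∞) * w T)
    _ = ∑ T : Finset (Fin (m + 1)), (((T.card + 1) * (m + 1 - T.card) : ℕ) : ℝ≥0∞) * w T := by
        refine Finset.sum_congr rfl fun T _ => ?_
        rw [Finset.sum_const, Finset.card_compl, Fintype.card_fin, nsmul_eq_mul, ← mul_assoc, ← Nat.cast_mul,
          mul_comm (m + 1 - T.card)]

/-! ## The identity -/

/-- **The summand at fixed `p`, sector by sector**: `N · [p ≠ 0]·weightedOcc p Ψ =
Σ_S |S| Σ_{i∈S} [p ≠ 0]·∫|P_i^{(p)} Q_{S∖{i}} Ψ|²`. [folklore] -/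
theorem natCast_mul_indicator_weightedOcc (hL : 0 < L) (Ψ : PeriodicTrialState (m + 1) L) (p : Fin 3 → ℤ) :
    ((m + 1 : ℕ) : ℝ≥0∞) * {p : Fin 3 → ℤ | p ≠ 0}.indicator (fun p => weightedOcc m L p Ψ.ψ) p =
      ∑ S : Finset (Fin (m + 1)), (S.card : ℝ≥0∞) * ∑ i ∈ S, {p : Fin 3 → ℤ | p ≠ 0}.indicator
        (fun p => ∫⁻ X in cellN (m + 1) L,
          (‖fourierAvg m L p i (modeProj (m + 1) L (S.erase i) Ψ.ψ) X‖₊ : ℝ≥0∞) ^ 2) p := by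
  have hψ : Continuous Ψ.ψ := Ψ.contDiff.continuous
  have hN0 : ((m + 1 : ℕ) : ℝ≥0∞) ≠ 0 := Nat.cast_ne_zero.2 (Nat.succ_ne_zero m)
  have hNtop : ((m + 1 : ℕ) : ℝ≥0∞) ≠ ⊤ := ENNReal.natCast_ne_top _
  by_cases hp : p = 0
  · have hnot : p ∉ {p : Fin 3 → ℤ | p ≠ 0} := fun h => h hp
    simp only [Set.indicator_of_notMem hnot, Finset.sum_const_zero, mul_zero]
  · have hmem : p ∈ {p : Fin 3 → ℤ | p ≠ 0} := hp
    simp only [Set.indicator_of_mem hmem]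
    rw [weightedOcc_eq, ← mul_assoc, ENNReal.mul_inv_cancel hN0 hNtop, one_mul,
      lintegral_sum_fourierAvg hL p hψ Ψ.symm]
    refine Finset.sum_congr rfl fun S _ => ?_
    congr 1
    refine Finset.sum_congr rfl fun i hi => ?_
    rw [Sector.modeProj_fourierAvg_of_mem hL hp hi hψ]

/-- **Summation over `p` through the sectors**: `N · Σ_{p≠0} weightedOcc p Ψ = Σ_S |S| Σ_{i∈S} w_{S∖{i}}(Ψ)`.
[folklore] -/
theorem natCast_mul_tsum_weightedOcc_eq_sum_erase (hL : 0 < L) (Ψ : PeriodicTrialState (m + 1) L) :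
    ((m + 1 : ℕ) : ℝ≥0∞) * ∑' p : Fin 3 → ℤ, {p : Fin 3 → ℤ | p ≠ 0}.indicator (fun p => weightedOcc m L p Ψ.ψ) p =
      ∑ S : Finset (Fin (m + 1)), (S.card : ℝ≥0∞) * ∑ i ∈ S, compMass m L (S.erase i) Ψ.ψ := by
  have hψ : Continuous Ψ.ψ := Ψ.contDiff.continuous
  rw [← ENNReal.tsum_mul_left, tsum_congr (natCast_mul_indicator_weightedOcc hL Ψ),
    Summable.tsum_finsetSum (fun S _ => ENNReal.summable)]
  refine Finset.sum_congr rfl fun S _ => ?_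
  rw [ENNReal.tsum_mul_left, Summable.tsum_finsetSum (fun i _ => ENNReal.summable)]
  congr 1
  refine Finset.sum_congr rfl fun i _ => ?_
  exact tsum_indicator_lintegral_fourierAvg_modeProj hL (Finset.notMem_erase i S) hψ

/-- **The second-moment count identity**: for a periodic trial state,
`N · Σ_{p≠0} weightedOcc p Ψ = Σ_T (|T|+1)(N−|T|) w_T(Ψ)` (`= ⟨Ψ, (n̂₀+1)(N−n̂₀)Ψ⟩`). [folklore] -/
theorem natCast_mul_tsum_weightedOcc (hL : 0 < L) (Ψ : PeriodicTrialState (m + 1) L) :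
    ((m + 1 : ℕ) : ℝ≥0∞) * ∑' p : Fin 3 → ℤ, {p : Fin 3 → ℤ | p ≠ 0}.indicator (fun p => weightedOcc m L p Ψ.ψ) p =
      ∑ T : Finset (Fin (m + 1)), (((T.card + 1) * (m + 1 - T.card) : ℕ) : ℝ≥0∞) * compMass m L T Ψ.ψ := by
  rw [natCast_mul_tsum_weightedOcc_eq_sum_erase hL Ψ]
  exact sum_card_mul_sum_erase (fun T => compMass m L T Ψ.ψ)

end SecondMoment

/-- **Part 1 of `stub_bandFromWindow` (registered helper statement): the second-moment count identity** — for a periodic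
trial state of `N = m + 1` bosons, `N · Σ_{p≠0} N⁻¹‖a₀†a_pΨ‖² = Σ_T (|T|+1)(N−|T|) ∫|Q_T Ψ|²`. [folklore] -/
theorem secondMoment_natCast_mul_tsum_weightedOcc :
    ∀ (m : ℕ) (L : ℝ), 0 < L →
      ∀ Ψ : Literature.MathematicalPhysics.QuantumManyBody.BoseGas.PeriodicTrialState (m + 1) L,
        ((m + 1 : ℕ) : ENNReal) *
            ∑' p : Fin 3 → ℤ, {p : Fin 3 → ℤ | p ≠ 0}.indicator (fun p => weightedOcc m L p Ψ.ψ) p =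
          ∑ T : Finset (Fin (m + 1)), (((T.card + 1) * (m + 1 - T.card) : ℕ) : ENNReal) * compMass m L T Ψ.ψ :=
  fun _ _ hL Ψ => SecondMoment.natCast_mul_tsum_weightedOcc hL Ψ

end Summit.AtomisticToContinuum.BoseEinsteinCondensation.Cruxes.GDTransfer.Seeded

end
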